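import Summits.FinalStateConjecture.FinalStateConjecture.Theorems.SwallowTheDatumUniversalWitnessFamilyStubRegionOneScriAlgebra
import Literature.Geometry.Lorentzian.ModelData
import Literature.Geometry.Lorentzian.OpensCausality
import HarnessLib

/-!
# Stub `stub_regionOneScri` of crux `SwallowTheDatum.UniversalWitnessFamily`
# (stmt-FinalStateConjecture-10051, line `Sketch`), part 2/4: the causal future of the outer shell
# sphere

In the Schwarzschild exterior `(Kerr.region 0 (2M), g_{M,0}, −g♯dt*)` with the static slice map
`ψ(y) = (2M log(r/2M − 1), (1 + M/2‖y‖)² y)`, `r = ‖y‖ (1 + M/2‖y‖)²`, of the isotropic sheet, the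
causal future of the sphere `ψ{‖y‖ = R}` (areal radius `r₂ = R (1 + M/2R)²`) contains every point with
`r > r₂` and retarded time `u ≥ −r*(r₂)` (`mem_causalFuture_outerSphere`): such a point is the endpoint
of the explicit radial curve `σ ↦ (t = λ (r*(r(σ)) − r*(r₂)), r(σ) = 2M + (r₂ − 2M) e^σ)` at its own
angle, with `λ ≥ 1`, whose velocity `(λ r + 2M, ((r − 2M)/r) x⃗)` is future causal (`causal_of_radial`,
`g = r (r − 2M)(1 − λ²) ≤ 0`). The velocity of an explicit curve in an open subset of `E4` is computed
through the inclusion (`velocity_mk`).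

References: B. O'Neill, *Semi-Riemannian geometry* (1983), Ch. 14, pp. 402–403; M. Dafermos,
I. Rodnianski, arXiv:0811.0354, §2.6.2, §5.1; C. W. Misner, K. S. Thorne, J. A. Wheeler, *Gravitation*
(1973), (31.22).
-/

set_option linter.dupNamespace false

noncomputable section

namespace Summit.FinalStateConjecture.FinalStateConjecture.Theorems.SwallowTheDatum.UniversalWitnessFamily

open scoped Manifold ContDiff Topology RealInnerProductSpace
open Set Function Filter Bundle Metric Literature.Geometry.Lorentzian

/-! ## Explicit curves in an open subset of `E4` -/

/-- **Velocity of an explicit curve in an open subset of `E4`.** If `c : ℝ → E4` takes values in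
`U` and has derivative `c'` at `t`, the curve `s ↦ ⟨c s, _⟩ : ℝ → U` is differentiable at `t` with
velocity `c'` (`d(Subtype.val) = id`, Lee 2013, Prop. 3.9). [folklore] -/
theorem velocity_mk {U : TopologicalSpace.Opens E4} {c : ℝ → E4} (h : ∀ s, c s ∈ U) {t : ℝ} {c' : E4}
    (hc : HasDerivAt c c' t) :
    MDifferentiableAt 𝓘(ℝ, ℝ) 𝓘(ℝ, E4) (fun s ↦ (⟨c s, h s⟩ : U)) t ∧
      velocity 𝓘(ℝ, E4) (fun s ↦ (⟨c s, h s⟩ : U)) t = c' := by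
  set γ : ℝ → U := fun s ↦ ⟨c s, h s⟩ with hγ
  have hval : Subtype.val ∘ γ = c := rfl
  have hcm : MDifferentiableAt 𝓘(ℝ, ℝ) 𝓘(ℝ, E4) (Subtype.val ∘ γ) t := by
    rw [hval]; exact mdifferentiableAt_iff_differentiableAt.2 hc.differentiableAt
  have hγd : MDifferentiableAt 𝓘(ℝ, ℝ) 𝓘(ℝ, E4) γ t :=
    (mdifferentiableAt_subtypeVal_comp_curve_iff U).1 hcm
  refine ⟨hγd, ?_⟩
  have h1 := velocity_subtypeVal_comp (I := 𝓘(ℝ, E4)) U γ t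
  rw [hval] at h1
  refine (h1.symm.trans ?_ : (velocity 𝓘(ℝ, E4) γ t : E4) = c')
  change mfderiv 𝓘(ℝ, ℝ) 𝓘(ℝ, E4) c t 1 = c'
  rw [mfderiv_eq_fderiv, hc.hasFDerivAt.fderiv]
  exact ContinuousLinearMap.toSpanSingleton_apply_one ℝ c'

/-! ## Radially outgoing causal vectors of the exterior -/

/-- **The interpolated outgoing radial vectors are future causal.** At a point `z` of the exterior
with `r(z) = ρ > 2M`, the vector `w = (λρ + 2M, ((ρ − 2M)/ρ) z⃗)` — the velocity of the curve
`σ ↦ (t = λ (r* − r*₀), r = 2M + (r₀ − 2M)e^σ)` at fixed angle — satisfies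
`g(w, w) = ρ(ρ − 2M)(1 − λ²) ≤ 0` for `λ ≥ 1`, `w ≠ 0`, and `g(V, w) = −w⁰ < 0` for the orienting field
`V = −g♯dt*`. Dafermos–Rodnianski arXiv:0811.0354, §5.1. [folklore] -/
theorem causal_of_radial {M : ℝ} (hM : 0 ≤ M) {z w : E4} {ρ lam : ℝ} (hρ : 2 * M < ρ)
    (hzρ : E4.spatialNorm z = ρ) (hw0 : w 0 = lam * ρ + 2 * M)
    (hws : E4.spatial w = ((ρ - 2 * M) / ρ) • E4.spatial z) (hlam : 1 ≤ lam) :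
    Kerr.bilin M 0 z w w ≤ 0 ∧ w ≠ 0 ∧ Kerr.bilin M 0 z (Kerr.timeVector M 0 z) w < 0 := by
  have hρ0 : 0 < ρ := by linarith
  have hr : E4.spatialNorm z ≠ 0 := by rw [hzρ]; exact hρ0.ne'
  have hrad : 0 < Kerr.radius 0 z := by rw [Kerr.radius_zero_left, hzρ]; exact hρ0
  have hzz : ⟪E4.spatial z, E4.spatial z⟫ = ρ ^ 2 := by
    rw [real_inner_self_eq_norm_sq]; exact congrArg (· ^ 2) hzρ
  have hzw : ⟪E4.spatial z, E4.spatial w⟫ = (ρ - 2 * M) * ρ := by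
    rw [hws, real_inner_smul_right, hzz]; field_simp
  have hww : ⟪E4.spatial w, E4.spatial w⟫ = (ρ - 2 * M) ^ 2 := by
    rw [hws, real_inner_smul_left, real_inner_smul_right, hzz]; field_simp
  have hw0pos : 0 < w 0 := by rw [hw0]; nlinarith
  refine ⟨?_, ?_, ?_⟩
  · rw [Kerr.bilin_zero_spin_apply M hr, hzw, hww, hzρ, hw0]
    have e : -((lam * ρ + 2 * M) * (lam * ρ + 2 * M)) + (ρ - 2 * M) ^ 2 +
        2 * M / ρ * ((lam * ρ + 2 * M + (ρ - 2 * M) * ρ / ρ) * (lam * ρ + 2 * M + (ρ - 2 * M) * ρ / ρ)) =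
        ρ * (ρ - 2 * M) * (1 - lam ^ 2) := by
      field_simp; ring
    rw [e]
    have h1 : 0 ≤ ρ * (ρ - 2 * M) := by nlinarith
    have h2 : 1 - lam ^ 2 ≤ 0 := by nlinarith
    exact mul_nonpos_of_nonneg_of_nonpos h1 h2
  · intro h
    rw [h] at hw0pos
    simp at hw0pos
  · rw [Kerr.bilin_timeVector hrad]
    linarith

/-! ## The causal future of the outer shell sphere contains `{r > r₂, u ≥ −r*(r₂)}` -/

/-- Areal-radius arithmetic of the isotropic chart: `ρ (1 + M/2ρ)² > 2M` for `ρ > M/2 > 0`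
(`ρ (1 + M/2ρ)² − 2M = (ρ − M/2)²/ρ`). Misner–Thorne–Wheeler 1973, (31.22). [folklore] -/
theorem two_mul_lt_arealRadius {M ρ : ℝ} (hM : 0 < M) (hρ : M / 2 < ρ) :
    2 * M < ρ * (1 + M / (2 * ρ)) ^ 2 := by
  have hρ0 : 0 < ρ := by linarith
  have key : ρ * (1 + M / (2 * ρ)) ^ 2 - 2 * M = (ρ - M / 2) ^ 2 / ρ := by
    field_simp
    ring
  have hpos : 0 < (ρ - M / 2) ^ 2 / ρ := div_pos (by nlinarith) hρ0
  linarith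

/-- **The causal future of the outer shell sphere.** In the Schwarzschild exterior
`(Kerr.region 0 (2M), g_{M,0}, −g♯dt*)`, let `ψ` be the static-slice map
`y ↦ (2M log(r/2M − 1), (1 + M/2‖y‖)² y)`, `r = ‖y‖(1 + M/2‖y‖)²`, of the isotropic sheet, and let
`r₂ = R (1 + M/2R)²` be the areal radius of the sphere `{‖y‖ = R}`, `R > M/2`. Every point `x` with
`r(x) > r₂` and retarded time `u(x) ≥ −r*(r₂)` lies in `J⁺(ψ{‖y‖ = R})`: it is the endpoint of the
radial curve `σ ↦ (t = λ (r*(r(σ)) − r*(r₂)), r(σ) = 2M + (r₂ − 2M) e^σ)` at the angle of `x`, issuing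
from the sphere point below `x`, with `λ = t(x)/(r*(r(x)) − r*(r₂)) ≥ 1` (`t = t* − 2M log(r/2M − 1)` the
static time), which is future causal (`causal_of_radial`). This is the exterior of the outgoing null
cone `u = −r*(r₂)` above the static slice. Dafermos–Rodnianski arXiv:0811.0354, §2.6.2, §5.1;
O'Neill 1983, Ch. 14, pp. 402–403. [folklore] -/
theorem mem_causalFuture_outerSphere [Kerr.Facts] {M : ℝ} (hM : 0 < M)
    (ψ : Schwarzschild.isotropicExterior M → Kerr.region 0 (Kerr.rPlus M 0))
    (hψ : ∀ y, (ψ y : E4) =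
      E4.ofTimeSpace (2 * M * Real.log (‖(y : E3)‖ * (1 + M / (2 * ‖(y : E3)‖)) ^ 2 / (2 * M) - 1))
        ((1 + M / (2 * ‖(y : E3)‖)) ^ 2 • (y : E3)))
    {R : ℝ} (hR : M / 2 < R) (x : Kerr.region 0 (Kerr.rPlus M 0))
    (hxr : R * (1 + M / (2 * R)) ^ 2 < E4.spatialNorm (x : E4))
    (hxu : -(R * (1 + M / (2 * R)) ^ 2 + 2 * M * Real.log (R * (1 + M / (2 * R)) ^ 2 / (2 * M) - 1)) ≤
      (x : E4) 0 - E4.spatialNorm (x : E4) - 4 * M * Real.log (E4.spatialNorm (x : E4) / (2 * M) - 1)) :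
    x ∈ (Kerr.smoothMetric M 0 (Kerr.rPlus M 0)).causalFuture
      ((Kerr.timeOrientation M 0 (Kerr.rPlus M 0) hM.le).ofLE le_top)
      (ψ '' {y | ‖(y : E3)‖ = R}) := by
  -- notation and positivity
  set r₂ := R * (1 + M / (2 * R)) ^ 2 with hr₂_def
  set rq := E4.spatialNorm (x : E4) with hrq_def
  set X : E3 := E4.spatial (x : E4) with hX_def
  have hXn : ‖X‖ = rq := rfl
  have h2M : 0 < 2 * M := by positivity
  have hr₂M : 2 * M < r₂ := two_mul_lt_arealRadius hM hR
  have hrq2 : 2 * M < rq := hr₂M.trans hxr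
  have hR0 : 0 < R := by linarith
  have hrq0 : 0 < rq := by linarith
  have hr₂0 : 0 < r₂ := by linarith
  have hfac : (1 + M / (2 * R)) ^ 2 = r₂ / R := by rw [hr₂_def]; field_simp
  -- the sphere point below `x`
  set y₀ : E3 := (R / rq) • X with hy₀_def
  have hy₀n : ‖y₀‖ = R := by
    rw [hy₀_def, norm_smul, Real.norm_of_nonneg (by positivity), hXn]; field_simp
  have hy₀m : y₀ ∈ Schwarzschild.isotropicExterior M := by
    rw [Schwarzschild.mem_isotropicExterior, hy₀n]; exact hR
  -- parameters of the curve
  set κ := Real.log (r₂ / (2 * M) - 1) with hκ_def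
  set tq := (x : E4) 0 - 2 * M * Real.log (rq / (2 * M) - 1) with htq_def
  set σq := Real.log ((rq - 2 * M) / (r₂ - 2 * M)) with hσq_def
  have hquot : 1 < (rq - 2 * M) / (r₂ - 2 * M) := by
    rw [one_lt_div (by linarith)]; linarith
  have hσq : 0 < σq := Real.log_pos hquot
  have hne₂ : r₂ - 2 * M ≠ 0 := ne_of_gt (by linarith)
  have hlogq : Real.log (rq / (2 * M) - 1) = σq + κ := by
    rw [hσq_def, hκ_def, ← Real.log_mul (by positivity) (by
      rw [sub_ne_zero, ne_eq, div_eq_one_iff_eq h2M.ne']; linarith)]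
    congr 1
    field_simp
  -- the tortoise separation `D = r*(rq) − r*(r₂) = rq − r₂ + 2M σq > 0` and the slope `λ = tq/D ≥ 1`
  set D := (rq + 2 * M * Real.log (rq / (2 * M) - 1)) - (r₂ + 2 * M * Real.log (r₂ / (2 * M) - 1))
    with hD_def
  have hdiff : D = rq - r₂ + 2 * M * σq := by
    rw [hD_def, hlogq]; ring
  have hdpos : 0 < D := sub_pos.2 (rstar_lt_rstar hM hr₂M hxr)
  set lam := tq / D with hlam_def
  have htq : tq = lam * D := by
    rw [hlam_def, div_mul_cancel₀ _ hdpos.ne']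
  have hlam : 1 ≤ lam := by
    rw [hlam_def, le_div_iff₀ hdpos, one_mul]
    have hu : (x : E4) 0 - E4.spatialNorm (x : E4) -
        4 * M * Real.log (E4.spatialNorm (x : E4) / (2 * M) - 1) =
        tq - (rq + 2 * M * Real.log (rq / (2 * M) - 1)) := by
      simp only [htq_def, ← hrq_def]; ring
    rw [hD_def]
    linarith
  -- the curve `σ ↦ (T σ, (ρ σ / rq) X)`
  set ρ : ℝ → ℝ := fun σ ↦ 2 * M + (r₂ - 2 * M) * Real.exp σ with hρ_def
  set T : ℝ → ℝ := fun σ ↦ lam * (ρ σ + 2 * M * σ - r₂) + 2 * M * σ + 2 * M * κ with hT_def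
  set c : ℝ → E4 := fun σ ↦ T σ • E4.ofTimeSpace 1 0 + (ρ σ / rq) • E4.ofTimeSpace 0 X with hc_def
  have hc_eq : ∀ σ, c σ = E4.ofTimeSpace (T σ) ((ρ σ / rq) • X) := by
    intro σ
    rw [hc_def]
    simp only
    rw [← E4.ofTimeSpace_smul, ← E4.ofTimeSpace_smul, ← E4.ofTimeSpace_add]
    simp
  have hρM : ∀ σ, 2 * M < ρ σ := fun σ ↦ by
    have : 0 < (r₂ - 2 * M) * Real.exp σ := mul_pos (by linarith) (Real.exp_pos σ)
    simp only [hρ_def]; linarith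
  have hcn : ∀ σ, E4.spatialNorm (c σ) = ρ σ := fun σ ↦ by
    rw [hc_eq, E4.spatialNorm_ofTimeSpace, norm_smul, hXn,
      Real.norm_of_nonneg (div_nonneg (by linarith [hρM σ]) hrq0.le)]
    field_simp
  have hcmem : ∀ σ, c σ ∈ Kerr.region 0 (Kerr.rPlus M 0) := fun σ ↦ by
    rw [Kerr.mem_region, Kerr.radius_zero_left, Kerr.rPlus_zero_right hM.le, hcn,
      max_eq_left h2M.le]
    exact hρM σ
  -- derivatives
  have hρd : ∀ σ, HasDerivAt ρ (ρ σ - 2 * M) σ := fun σ ↦ by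
    have h := ((Real.hasDerivAt_exp σ).const_mul (r₂ - 2 * M)).const_add (2 * M)
    have e : ρ σ - 2 * M = (r₂ - 2 * M) * Real.exp σ := by simp only [hρ_def]; ring
    rw [e]
    exact h
  have hT_fun : T = fun σ ↦ lam * ρ σ + (lam * (2 * M) + 2 * M) * σ + (2 * M * κ - lam * r₂) := by
    rw [hT_def]
    funext σ
    ring
  have hTd : ∀ σ, HasDerivAt T (lam * ρ σ + 2 * M) σ := fun σ ↦ by
    have h := (((hρd σ).const_mul lam).add
      ((hasDerivAt_id' σ).const_mul (lam * (2 * M) + 2 * M))).add_const (2 * M * κ - lam * r₂)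
    rw [hT_fun]
    have e : lam * ρ σ + 2 * M = lam * (ρ σ - 2 * M) + (lam * (2 * M) + 2 * M) * 1 := by ring
    rw [e]
    exact h
  have hcd : ∀ σ, HasDerivAt c
      ((lam * ρ σ + 2 * M) • E4.ofTimeSpace 1 0 + ((ρ σ - 2 * M) / rq) • E4.ofTimeSpace 0 X) σ :=
    fun σ ↦ ((hTd σ).smul_const _).add (((hρd σ).div_const rq).smul_const _)
  -- the velocity in `(t*, x⃗)` form
  have hw_eq : ∀ σ,
      (lam * ρ σ + 2 * M) • E4.ofTimeSpace 1 0 + ((ρ σ - 2 * M) / rq) • E4.ofTimeSpace 0 X =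
        E4.ofTimeSpace (lam * ρ σ + 2 * M) (((ρ σ - 2 * M) / rq) • X) := fun σ ↦ by
    rw [← E4.ofTimeSpace_smul, ← E4.ofTimeSpace_smul, ← E4.ofTimeSpace_add]
    simp
  -- endpoints
  set γ : ℝ → Kerr.region 0 (Kerr.rPlus M 0) := fun σ ↦ ⟨c σ, hcmem σ⟩ with hγ_def
  have hρ0 : ρ 0 = r₂ := by simp [hρ_def]
  have hT0 : T 0 = 2 * M * κ := by
    rw [hT_fun]
    show lam * ρ 0 + (lam * (2 * M) + 2 * M) * 0 + (2 * M * κ - lam * r₂) = 2 * M * κ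
    rw [hρ0]; ring
  have hγ0 : γ 0 = ψ ⟨y₀, hy₀m⟩ := by
    apply Subtype.ext
    have hψ0 : (ψ ⟨y₀, hy₀m⟩ : E4) = E4.ofTimeSpace
        (2 * M * Real.log (‖y₀‖ * (1 + M / (2 * ‖y₀‖)) ^ 2 / (2 * M) - 1))
        ((1 + M / (2 * ‖y₀‖)) ^ 2 • y₀) := hψ ⟨y₀, hy₀m⟩
    rw [hψ0]
    change c 0 = _
    have hRr : R * (r₂ / R) = r₂ := by field_simp
    have hcoef : r₂ / R * (R / rq) = r₂ / rq := by field_simp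
    rw [hc_eq, hT0, hρ0, hy₀n, hfac, hy₀_def, smul_smul, hRr, hcoef]
  have hρq : ρ σq = rq := by
    simp only [hρ_def, hσq_def]
    rw [Real.exp_log (by positivity)]
    field_simp
    ring
  have hTq : T σq = (x : E4) 0 := by
    have e1 : T σq = lam * D + 2 * M * (σq + κ) := by
      rw [hT_fun, hdiff]
      show lam * ρ σq + (lam * (2 * M) + 2 * M) * σq + (2 * M * κ - lam * r₂) =
        lam * (rq - r₂ + 2 * M * σq) + 2 * M * (σq + κ)
      rw [hρq]; ring
    rw [e1, ← htq, ← hlogq, htq_def]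
    ring
  have hγq : γ σq = x := by
    apply Subtype.ext
    change c σq = _
    rw [hc_eq, hTq, hρq, div_self hrq0.ne', one_smul, hX_def]
    exact E4.ofTimeSpace_time_spatial _
  -- the curve is future causal
  refine Or.inr ⟨ψ ⟨y₀, hy₀m⟩, ⟨⟨y₀, hy₀m⟩, hy₀n, rfl⟩, γ, 0, σq, hσq, fun σ _ ↦ ?_, hγ0, hγq⟩
  obtain ⟨hd, hv⟩ := velocity_mk hcmem (hcd σ)
  refine ⟨hd, ?_⟩
  rw [hv, hw_eq]
  obtain ⟨h1, h2, h3⟩ := causal_of_radial hM.le (z := c σ)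
    (w := E4.ofTimeSpace (lam * ρ σ + 2 * M) (((ρ σ - 2 * M) / rq) • X)) (hρM σ) (hcn σ)
    (by simp) (by
      rw [E4.spatial_ofTimeSpace, hc_eq, E4.spatial_ofTimeSpace, smul_smul]
      congr 1
      have hρne : ρ σ ≠ 0 := (h2M.trans (hρM σ)).ne'
      field_simp) hlam
  exact ⟨⟨h1, h2⟩, h3⟩

/-- **Anchor of part 2** (registered sub-goal `regionOneScri_outerSphereCone` of stub
`stub_regionOneScri`): `{r > r₂, u ≥ −r*(r₂)} ⊆ J⁺(ψ{‖y‖ = R})` (`mem_causalFuture_outerSphere`).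
Dafermos–Rodnianski arXiv:0811.0354, §2.6.2, §5.1. -/
theorem regionOneScri_outerSphereCone :
    ∀ [Kerr.Facts] (M : ℝ) (hM : 0 < M) (ψ : Schwarzschild.isotropicExterior M → Kerr.region 0
      (Kerr.rPlus M 0)), (∀ y, (ψ y : E4) = E4.ofTimeSpace (2 * M * Real.log (‖(y : E3)‖ * (1 + M /
      (2 * ‖(y : E3)‖)) ^ 2 / (2 * M) - 1)) ((1 + M / (2 * ‖(y : E3)‖)) ^ 2 • (y : E3))) → ∀ (R :
      ℝ), M / 2 < R → ∀ x : Kerr.region 0 (Kerr.rPlus M 0), R * (1 + M / (2 * R)) ^ 2 <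
      E4.spatialNorm (x : E4) → -(R * (1 + M / (2 * R)) ^ 2 + 2 * M * Real.log (R * (1 + M / (2 *
      R)) ^ 2 / (2 * M) - 1)) ≤ (x : E4) 0 - E4.spatialNorm (x : E4) - 4 * M * Real.log
      (E4.spatialNorm (x : E4) / (2 * M) - 1) → x ∈ (Kerr.smoothMetric M 0 (Kerr.rPlus M
      0)).causalFuture ((Kerr.timeOrientation M 0 (Kerr.rPlus M 0) hM.le).ofLE le_top) (ψ '' {y |
      ‖(y : E3)‖ = R}) :=
  fun _ hM ψ hψ _ hR x hxr hxu ↦ mem_causalFuture_outerSphere hM ψ hψ hR x hxr hxu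

end Summit.FinalStateConjecture.FinalStateConjecture.Theorems.SwallowTheDatum.UniversalWitnessFamily

end
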